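import Summits.AtomisticToContinuum.HydrodynamicLimit.Theorems.JParityClosureOddContactSymmetryCollisionCountRung0
import Literature.MathematicalPhysics.KineticTheory.HardSphereCampbellWindows
import HarnessLib

/-!
# Bounded marks have finite expected collision pair sums under the invariant Gibbs law (line `KineticSlabSketch`, piece P5 of S1a)

Crux `JParityClosure.OddContactSymmetry` (stmt-AtomisticToContinuum-17722, rev 5), line `KineticSlabSketch`, lead
`prover-line-stmt-AtomisticToContinuum-17722-c1-0` (cycle 2).  Piece P5 (counting) of the statics plan for the registered
stub S1a `stub_slabCentring`, which also DISCHARGES the finiteness hypothesis of the signed Campbell formula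
(`integral_collisionPairSum_localGibbsLaw_const`, piece P2): for a mark `g ≤ C` the collision pair sum over `(0, τ]`
is at most `2C ×` the number of collisions in `[0, τ]` on the good set (exactly two ordered contact pairs per collision
time, `IsHardSphereTrajectory.card_contactPairs_eq_two`, the torus with `ε < 1/2` being hard-sphere regular), so by the
PROVED rung-0 collision-count bound `lintegral_numCollisions_le` (p88324)
`∫⁻ collisionPairSum (Ioc 0 τ) g dG_N ≤ 2C · 12 v₁ ε² (N+1)N · 2E‖v‖ · τ < ∞`
(`lintegral_collisionPairSum_le_of_le`, `lintegral_collisionPairSum_lt_top_of_le`).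
-/

noncomputable section

open scoped BigOperators Classical InnerProductSpace ENNReal Topology NNReal
open Set MeasureTheory Filter
open Literature.Analysis.FluidPDE Literature.MathematicalPhysics.KineticTheory

namespace Summit.AtomisticToContinuum.HydrodynamicLimit.Theorems.OddContactSymmetryKineticSlab

/-- Pathwise (good set): a collision pair sum over `(0, τ]` of a mark bounded by `C` is at most `2C ×` the number of
collisions in `[0, τ]` (two ordered contact pairs per collision time in the regular torus geometry). [folklore] -/
theorem collisionPairSum_le_two_mul_numCollisions {σ : ℝ} (hσ : 0 < σ) (hσ2 : σ < 1 / 2) {N : ℕ}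
    (Φ : HardSphereFlow (Torus.geometry (Fin 3)) (hsDiameter σ N) (N + 1))
    {g : Config (N + 1) (Fin 3) T3 → Fin (N + 1) → Fin (N + 1) → ℝ≥0∞} {C : ℝ≥0∞} (hg : ∀ w i j, g w i j ≤ C)
    {z : Config (N + 1) (Fin 3) T3} (hz : z ∈ Φ.good) (τ : ℝ) :
    Φ.collisionPairSum (Ioc 0 τ) (fun _ w i j => g w i j) z ≤
      2 * C * (numCollisions (Torus.geometry (Fin 3)) (hsDiameter σ N) (fun s => Φ.flow s z) 0 τ : ℝ≥0∞) := by
  have hε2 : hsDiameter σ N < 2⁻¹ := by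
    have := (hsDiameter_le hσ.le N).trans_lt hσ2; rwa [one_div] at this
  have hfin := Φ.finite_collisionTimes_inter hz (Ioc_subset_Icc_self : Ioc 0 τ ⊆ Icc 0 τ)
  have hfinI := Φ.finite_collisionTimes_inter hz (Subset.rfl : Icc 0 τ ⊆ Icc 0 τ)
  have hG := Torus.isHardSphereRegular_geometry (d := Fin 3) hε2
  have htraj := Φ.isTrajectory z hz
  unfold HardSphereFlow.collisionPairSum
  rw [collisionPairSum_eq_finset_sum hfin]
  calc ∑ t ∈ hfin.toFinset, ∑ p ∈ contactPairs (Torus.geometry (Fin 3)) (hsDiameter σ N) (Φ.flow t z), g (Φ.flow t z) p.1 p.2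
      ≤ ∑ t ∈ hfin.toFinset, ∑ _p ∈ contactPairs (Torus.geometry (Fin 3)) (hsDiameter σ N) (Φ.flow t z), C :=
        Finset.sum_le_sum fun t _ => Finset.sum_le_sum fun p _ => hg _ _ _
    _ = ∑ t ∈ hfin.toFinset, 2 * C := by
        refine Finset.sum_congr rfl fun t ht => ?_
        rw [Finset.sum_const, htraj.card_contactPairs_eq_two hG (hfin.mem_toFinset.1 ht).1, two_nsmul, two_mul]
    _ = 2 * C * ((collisionTimes (Torus.geometry (Fin 3)) (hsDiameter σ N) (fun s => Φ.flow s z) ∩ Ioc 0 τ).ncard : ℝ≥0∞) := by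
        rw [Finset.sum_const, nsmul_eq_mul, Set.ncard_eq_toFinset_card _ hfin]; ring
    _ ≤ 2 * C * (numCollisions (Torus.geometry (Fin 3)) (hsDiameter σ N) (fun s => Φ.flow s z) 0 τ : ℝ≥0∞) := by
        unfold numCollisions
        exact mul_le_mul' le_rfl
          (by exact_mod_cast Set.ncard_le_ncard (inter_subset_inter_right _ Ioc_subset_Icc_self) hfinI)

/-- **Expected collision pair sums of bounded marks under the invariant homogeneous Gibbs law are `O(ε²N²τ)`** (piece P5
of S1a): for `0 < σ < 1/2` with `v₁σ³ ≤ 1/2`, constant profiles `a, θ > 0`, `u`, every hard-sphere flow `Φ`, every mark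
`g ≤ C` and `τ ≥ 0`, `∫⁻ collisionPairSum (Ioc 0 τ) g dG_N ≤ 2C · 12 v₁ ε² (N+1)N · 2E‖v‖ · τ`. [folklore] -/
theorem lintegral_collisionPairSum_le_of_le :
    ∀ {σ a θ : ℝ} (_hσ : 0 < σ) (_hσ2 : σ < 1 / 2) (_hlam : v₁ * σ ^ 3 ≤ 1 / 2) (_ha : 0 < a) (_hθ : 0 < θ)
    (u : V3) (N : ℕ) (Φ : HardSphereFlow (Torus.geometry (Fin 3)) (hsDiameter σ N) (N + 1))
    {g : Config (N + 1) (Fin 3) T3 → Fin (N + 1) → Fin (N + 1) → ℝ≥0∞} {C : ℝ≥0∞} (_hg : ∀ w i j, g w i j ≤ C)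
    {τ : ℝ} (_hτ : 0 ≤ τ),
    ∫⁻ z, Φ.collisionPairSum (Ioc 0 τ) (fun _ w i j => g w i j) z
        ∂(localGibbsLaw σ (fun _ => a) (fun _ => u) (fun _ => θ) N Φ) ≤
      2 * C * ENNReal.ofReal (12 * v₁ * hsDiameter σ N ^ 2 * ((N + 1 : ℝ) * N) *
        (2 * ∫ v, ‖v‖ ∂gaussMeasure u θ) * τ) := by
  intro σ a θ hσ hσ2 hlam ha hθ u N Φ g C hg τ hτ
  set G := localGibbsLaw σ (fun _ => a) (fun _ => u) (fun _ => θ) N Φ with hG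
  have hac : G ≪ liouville (Torus.geometry (Fin 3)) (N + 1) (hsDiameter σ N) := by
    rw [hG, localGibbsLaw, particleLaw_eq]; exact withDensity_absolutelyContinuous _ _
  have hgood : ∀ᵐ z ∂G, z ∈ Φ.good := hac Φ.ae_mem_good
  calc ∫⁻ z, Φ.collisionPairSum (Ioc 0 τ) (fun _ w i j => g w i j) z ∂G
      ≤ ∫⁻ z, 2 * C * Φ.good.indicator (fun z => (numCollisions (Torus.geometry (Fin 3)) (hsDiameter σ N)
          (fun s => Φ.flow s z) 0 τ : ℝ≥0∞)) z ∂G := by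
        refine lintegral_mono_ae ?_
        filter_upwards [hgood] with z hz
        rw [indicator_of_mem hz]
        exact collisionPairSum_le_two_mul_numCollisions hσ hσ2 Φ hg hz τ
    _ = 2 * C * ∫⁻ z, Φ.good.indicator (fun z => (numCollisions (Torus.geometry (Fin 3)) (hsDiameter σ N)
          (fun s => Φ.flow s z) 0 τ : ℝ≥0∞)) z ∂G := by
        have hε2 : hsDiameter σ N < 2⁻¹ := by
          have := (hsDiameter_le hσ.le N).trans_lt hσ2; rwa [one_div] at this
        rw [← lintegral_const_mul'' _ (measurable_indicator_numCollisions hε2 Φ 0 τ).aemeasurable]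
    _ ≤ 2 * C * ENNReal.ofReal (12 * v₁ * hsDiameter σ N ^ 2 * ((N + 1 : ℝ) * N) *
          (2 * ∫ v, ‖v‖ ∂gaussMeasure u θ) * τ) := by
        gcongr
        exact lintegral_numCollisions_le hσ hσ2 hlam ha hθ u N Φ hτ

end Summit.AtomisticToContinuum.HydrodynamicLimit.Theorems.OddContactSymmetryKineticSlab

end
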